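import Summits.Langlands.Langlands.Theses.AdjointEulerNumerical
import Literature.NumberTheory.EllipticCurves.AnalyticRank
import Literature.NumberTheory.EllipticCurves.LFunctionSmulProofs
import Literature.NumberTheory.EllipticCurves.SelmerFirstZeroTotallyReal
import Literature.NumberTheory.Automorphic.TotallyRealModularity
import HarnessLib

/-!
# Crux `PlecticLegs.PlecticPointsLB` (stmt-BirchSwinnertonDyer-17518), line `Sketch` rev 2 —
# stub 4 `stub_entireOfAutomorphic`: the junk bridge routed through modularity

Registered stub 4 of `Cruxes/PlecticPointsLB/Lines/Sketch.lean` (rev 2). The tree's `V.analyticRank` is the honest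
order of vanishing only when `V.HasEntireLFunction`; over `ℚ` the junk branch is excluded by
`WeierstrassCurve.hasEntireLFunction_of_analyticRank_ne_zero`, over a general number field that absolute-convergence
argument fails. The line needs entirety for ALL elliptic curves over totally real fields, and gets it from
MODULARITY, which stub 2 assumes anyway: if (a) every integral Weierstrass model `E` over `𝓞 F` with `Δ(E) ≠ 0` that is
automorphic of weight zero (`IsAutomorphicOfWeightZero E`) has `L(E_F, s)` entire — Jacquet–Langlands entirety of
`L(s, π)` for cuspidal `π` on `GL₂/F` plus `L(E_F, s) = L(s − ½, π)` (local–global compatibility; Carayol, Taylor,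
Jarvis), a printed fact entering as a hypothesis (stub 1's fourth conjunct) — and (b) every such model IS automorphic of
weight zero (the Langlands-route crux `TotallyRealWeightZeroAutomorphic`, stmt-Langlands-2176), then every elliptic
`V/F` has entire `L`: take an integral model `C • E.baseChange F = V`
(`WeierstrassCurve.exists_variableChange_smul_baseChange_eq`), note `Δ(E) ≠ 0`, and transport entirety along the
`F`-isomorphism (`WeierstrassCurve.hasEntireLFunction_smul_iff`).
-/

set_option linter.dupNamespace false -- single-conjunct summit: Sub = Summit (D-0017)

open NumberField IsDedekindDomain

namespace Summit.BirchSwinnertonDyer.BirchSwinnertonDyer.Theorems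

open Literature.NumberTheory.EllipticCurves Literature.NumberTheory.Automorphic
open Summit.Langlands.Langlands.Theses.AdjointEulerNumerical (TotallyRealWeightZeroAutomorphic)

/-- An integral model of an elliptic curve has non-zero discriminant: if `C • E.baseChange F = V` with `V` elliptic
then `E.Δ ≠ 0` (`Δ(C • W) = u⁻¹² Δ(W)` and `Δ(E_F) = Δ(E)` in `F`). (Worker A, wave 1.) [folklore] -/
theorem integralModel_Δ_ne_zero {F : Type} [Field F] [NumberField F] {V : WeierstrassCurve F}
    [V.IsElliptic] {E : WeierstrassCurve (𝓞 F)} {C : WeierstrassCurve.VariableChange F}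
    (h : C • E.baseChange F = V) : E.Δ ≠ 0 := by
  intro hE
  apply V.isUnit_Δ.ne_zero
  rw [← h, WeierstrassCurve.variableChange_Δ, WeierstrassCurve.baseChange, WeierstrassCurve.map_Δ, hE,
    map_zero, mul_zero]

/-- **Stub 4 · `stub_entireOfAutomorphic` (line `Sketch`, rev 2).** If weight-zero automorphic integral models over
totally real fields have entire `L`-functions, and every integral model with `Δ ≠ 0` over every totally real field is
automorphic of weight zero, then every elliptic curve over a totally real field has an entire `L`-function. [folklore] -/
theorem stub_entireOfAutomorphic :
    (∀ (F : Type) [Field F] [NumberField F] [NumberField.IsTotallyReal F] (E : WeierstrassCurve (𝓞 F)),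
        E.Δ ≠ 0 → IsAutomorphicOfWeightZero E → (E.baseChange F).HasEntireLFunction) →
    TotallyRealWeightZeroAutomorphic →
    ∀ (F : Type) [Field F] [NumberField F] [NumberField.IsTotallyReal F] (V : WeierstrassCurve F)
      [V.IsElliptic], V.HasEntireLFunction := by
  intro hJL hMod F _ _ _ V _
  obtain ⟨E, C, h⟩ := V.exists_variableChange_smul_baseChange_eq (R := 𝓞 F)
  have hΔ : E.Δ ≠ 0 := integralModel_Δ_ne_zero h
  have hEF : (E.baseChange F).HasEntireLFunction := hJL F E hΔ (hMod F E hΔ)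
  haveI : (E.baseChange F).IsElliptic := by
    refine ⟨?_⟩
    rw [WeierstrassCurve.baseChange, WeierstrassCurve.map_Δ]
    exact (IsUnit.mk0 _ ((map_ne_zero_iff _ (IsFractionRing.injective (𝓞 F) F)).mpr hΔ))
  rw [← h]
  exact (WeierstrassCurve.hasEntireLFunction_smul_iff (E.baseChange F) C).mpr hEF

end Summit.BirchSwinnertonDyer.BirchSwinnertonDyer.Theorems
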